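import Summits.Langlands.Langlands.Theses.HolomorphicShadow
import Summits.Langlands.Langlands.Theorems.IrreducibilityBySelfDualityReciprocityUpToIrreducibilityIsobaricRigidity
import HarnessLib

/-!
# Route `HolomorphicShadow` — crux `SectorComplement` (stmt-Langlands-14623), line `pieces`:
# stub `stub_isobaricRigidityUnramified` (piece IR) modulo the route's two Jacquet–Shalika items

The registered stub `stub_isobaricRigidityUnramified` of the skeleton
`Summits/Langlands/Langlands/Cruxes/SectorComplement/Lines/pieces.lean` (piece IR of the strategist's
decomposition D★ of the junction crux `HolomorphicShadow.SectorComplement`) says: a cuspidal `π` of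
`GL_n(𝔸_K)` (`n ≥ 1`) is NOT, at almost every finite place, Satake-equal to an isobaric sum
`σ₁ ⊞ ⋯ ⊞ σ_k` of `k ≥ 2` cuspidals of `GL_{m_i}(𝔸_K)` (`m_i ≥ 1`) — isobaric rigidity at the
unramified places, H. Jacquet, J. Shalika, *On Euler products and the classification of automorphic
forms II*, Amer. J. Math. 103 (1981), Thm. 4.4 (with Arthur–Clozel, Ch. 3 §2 (2.2)–(2.3)).

`stub_isobaricRigidityUnramified_of_JS` proves EXACTLY the registered signature (as the conclusion)
from the route's own crux items `PairLBoundaryJS` (stmt-Langlands-13622: non-vanishing of partial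
Rankin–Selberg `L`-functions on `Re s = 1`) and `PairLPoleJS` (stmt-Langlands-19093: the pole of
`L^S(s, π × π̃)` at `s = 1`), BY NAME, through the landed
`Summit.Langlands.Langlands.Theorems.ReciprocityUpToIrreducibility.stub_isobaricRigidity` (whose
hypotheses, the Literature named facts `JacquetShalika1981_partialPairL_boundary_repData` /
`…_pole_repData`, are `δ`-equal to the two items).  It is the skeleton's own
`isobaricRigidityUnramified_of_JS`, moved to the tree so that the item records it.

HONEST STATUS: CONDITIONAL on two OPEN route items (13622, 19093 — Rankin–Selberg analysis with live
lines of their own); it does not close the stub by name.  The other four registered stubs of the line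
(`stub_weakExistence` = Buzzard–Gee Conj. 3.2.2 weak form, `stub_weakAutomorphyOffEvenArtin` =
Fontaine–Mazur–Langlands a.e. off the even Artin plane, `stub_pairCompatibilityAllData` = Taylor's
Conj. 7 at every place for every pinned datum, `stub_evenArtinPlaneOfMaass` = the Maass dictionary
with L-algebraicity + Artin data + transport) are open problems / uncarried formalizations and are
not touched here.  Nothing in this file proves reciprocity for any representation.

References: [JacquetShalikaAJM1981II] Thm. 4.4; [ArthurClozelAMS120] Ch. 3 §2.
-/

noncomputable section

set_option linter.dupNamespace false -- project-wide option; `Summit.Langlands.Langlands` is the mandated namespace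

open scoped NumberField
open Filter IsDedekindDomain
open Literature.NumberTheory.Automorphic Literature.NumberTheory.GaloisRepresentations
open Summit.Langlands.Langlands.Theses.HolomorphicShadow (PairLBoundaryJS PairLPoleJS)
open Summit.Langlands.Langlands.Theorems.ReciprocityUpToIrreducibility (stub_isobaricRigidity)

namespace Summit.Langlands.Langlands.Theorems.HolomorphicShadow

/-- **Stub `stub_isobaricRigidityUnramified` (piece IR) from the route items `PairLBoundaryJS` and
`PairLPoleJS` BY NAME** (CONDITIONAL on those two open items): a cuspidal `π` on `GL_n(𝔸_K)` is not
a.e.-Satake-equal to an isobaric sum of `k ≥ 2` cuspidals.  Proof: the landed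
`ReciprocityUpToIrreducibility.stub_isobaricRigidity` (Jacquet–Shalika II Thm. 4.4 from the boundary
non-vanishing and the pole count), the items being `δ`-equal to its named-fact hypotheses.  The
statement is the registered stub signature verbatim.
[cite: JacquetShalikaAJM1981II, Thm. 4.4] [cite: ArthurClozelAMS120, Ch. 3 §2 (2.2)–(2.3)] -/
theorem stub_isobaricRigidityUnramified_of_JS (hJSb : PairLBoundaryJS) (hJSp : PairLPoleJS) :
    ∀ (K : Type) [Field K] [NumberField K] (n : ℕ) (hcpt : Literature.NumberTheory.Automorphic.isCompact_glFiniteIntegralLevel n K) (π : Literature.NumberTheory.Automorphic.CuspidalAutomorphicRepData n K hcpt) (k : ℕ) (m : Fin k → ℕ) (hm : ∀ i, Literature.NumberTheory.Automorphic.isCompact_glFiniteIntegralLevel (m i) K) (σ : ∀ i, Literature.NumberTheory.Automorphic.CuspidalAutomorphicRepData (m i) K (hm i)), 0 < n → 2 ≤ k → (∀ i, 0 < m i) → ¬ ∀ᶠ v : IsDedekindDomain.HeightOneSpectrum (NumberField.RingOfIntegers K) in cofinite, ∀ α : Multiset ℂ, π.1.HasSatakeParamAt v α → ∃ β : Fin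 k → Multiset ℂ, (∀ i, (σ i).1.HasSatakeParamAt v (β i)) ∧ α = ∑ i, β i :=
  fun K _ _ n hcpt π k m hm σ hn hk hm0 => stub_isobaricRigidity hJSb hJSp K n hcpt π k m hm σ hn hk hm0

end Summit.Langlands.Langlands.Theorems.HolomorphicShadow

end
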